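import Literature.ModelTheory.FiniteModelTheory.LFPArith
import Literature.Computability.Complexity.TableauStep
import HarnessLib

/-!
# FO(IFP) with order simulates polynomial-time `FinTM2` computations

Topic `Literature/ModelTheory/FiniteModelTheory`; step 2 of the discharge of
`Literature.ModelTheory.FiniteModelTheory.exists_sentence_natOrder_of_mem_P` (Gurevich 1984, §4, Theorems 2–3,
(1) → (3); the "only if" half of Immerman–Vardi, Immerman 1986 / Immerman 1999, Thm. 4.10), for
the machine model of the tree's class `P`: Mathlib's multi-stack machines `Turing.FinTM2`.

THE INDUCTION (namespace `LFPSim`, parameters `tm : FinTM2`, tuple width `d`). A fact of the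
computation is a tuple `(t̄, p̄, ē)` — time `t < N ^ d` and position `p < N ^ d` as `d`-tuples,
and the one-hot code `ē` of a CONTENT `x : Content tm = (Option Λ × σ) ⊕ Σ k, Option (Sym tm k)`:
either the control (label, internal state; at position `0`) or the content of cell `p` of stack
`k`, counted from the TOP (an effective symbol `Sym tm k`, finite by `TM2Sim.finite_isSym`, or
blank). The body `simBody` of the fixed point `confRel` says: the fact is an initial fact
(`initF`: control `(main, init)`, the input word on the input stack — supplied by two abstract
builders `inLen`/`inTrue` realising a word `u`), or there are facts at time `t̄ - 1` exhibiting
some LOCAL DATA `w` (`matchesW`: control and the top-`D` cells of every stack,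
`D = TM2Sim.depth tm`, a finite type `LocalData tm`, so "some `w`" is a finite disjunction
`fOr`) and the fact is a conclusion of `w` (`conclW`: the new control and new windows are those
of ONE machine step on the truncated configuration `next w`, and below the new window the old
cells are shifted by the constant `D - |W'_k|`, the window lemma `TM2Sim.getElem?_stepTotal_stk`
of `TM2Window.lean`).

CORRECTNESS (`ifp_FSem_eq_conf`): the inflationary fixed point of (the semantics `FSem` of) the
body is exactly the set `Conf` of codes of TRUE facts about the run
`run tm c₀ t = stepTotal^[t] c₀`, by the ranked characterisation `ifp_eq_of_rank` of
`LFPArith.lean` with rank = time: soundness (`initSem_sound`, `conclSem_sound`, matching pins the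
local data down by code injectivity, `eq_ld_of_matchSem`) and completeness (`initSem_complete`,
`conclSem_complete`, `matchSem_ld`), under the hypotheses `2 ≤ N`, `D < N ^ d` and the height
bound "at all times `t < N ^ d` all stacks have height `≤ N ^ d`" (what a time bound supplies).
Consequently `eval_confRel`, and `eval_accF`: the sentence
`accF` holds iff at some time `t < N ^ d` the run has halted with a designated symbol on top of
the output stack.

## References

* Y. Gurevich, *Toward logic tailored for computational complexity*, LNM 1104 (1984), §4
  Theorems 2–3 (and §1–2: computations described by first-order sentences).
* N. Immerman, *Relational queries computable in polynomial time*, Inform. and Control 68 (1986),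
  Thm. (P ⊆ FO(LFP) with order); N. Immerman, *Descriptive Complexity* (1999), Thm. 4.10.
* M. Sipser, *Introduction to the Theory of Computation*, 3rd ed., Thm. 9.30 (tableau, via
  `TM2Window.lean`).
-/

namespace Literature.ModelTheory.FiniteModelTheory

open _root_.Computability Literature.Computability.Complexity Literature.Computability.Cryptography

/-! ## Simulation of a `FinTM2` computation in FO(IFP) with order: machine side -/

noncomputable section

namespace LFPSim

open Turing Literature.Computability.Complexity

variable (tm : FinTM2)

attribute [local instance] Turing.FinTM2.kFin Turing.FinTM2.ΛFin Turing.FinTM2.σFin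
  Turing.FinTM2.Γk₀Fin

/-- The window size: the stack-operation depth of the machine. [folklore] -/
noncomputable abbrev D : ℕ := TM2Sim.depth tm

/-- The effective (finite) alphabet of stack `k`: `FinTM2Sim.StackSym` of `TM2Circuits.lean`
(the subtype of `TM2Sim.IsSym tm k`, finite by `TM2Sim.finite_isSym`). [folklore] -/
abbrev Sym (k : tm.K) : Type := FinTM2Sim.StackSym tm k

open Literature.Computability.Complexity.FinTM2Sim (toSym toSym_of_isSym)

/-- `toSym` of an effective symbol (corollary of `FinTM2Sim.toSym_of_isSym`). [folklore] -/
theorem toSym_val (k : tm.K) (s : Sym tm k) : toSym tm k s.val = some s :=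
  toSym_of_isSym tm s.2

/-- Cell `j` (counted from the top) of stack `k` of a configuration: the effective symbol there,
`none` below the bottom (or for a non-effective symbol, which never occurs in a run). This is
`Tableau.cellAt c.stk j k` of `TableauStep.lean` with the arguments in the order used throughout
this file (stack first, then depth). [folklore] -/
noncomputable abbrev cell (c : tm.Cfg) (k : tm.K) (j : ℕ) : Option (Sym tm k) := Tableau.cellAt c.stk j k

/-- Unfolding `cell`. [folklore] -/
theorem cell_def (c : tm.Cfg) (k : tm.K) (j : ℕ) : cell tm c k j = ((c.stk k)[j]?).bind (toSym tm k) := rfl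

/-- For good configurations the cells are the stack entries. [folklore] -/
theorem cell_eq_of_good {c : tm.Cfg} (hc : TM2Sim.Good tm c) (k : tm.K) (j : ℕ) :
    (cell tm c k j).map Subtype.val = (c.stk k)[j]? := by
  rw [cell_def]
  rcases h : (c.stk k)[j]? with _ | γ
  · rfl
  · have hγ : TM2Sim.IsSym tm k γ := hc k γ (List.mem_of_getElem? h)
    rw [Option.bind_some]
    exact FinTM2Sim.toSym_val tm hγ

/-- Cells below the bottom of a stack are blank. [folklore] -/
theorem cell_eq_none_of_le {c : tm.Cfg} (k : tm.K) {j : ℕ} (h : (c.stk k).length ≤ j) :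
    cell tm c k j = none := by
  simp [cell_def, List.getElem?_eq_none h]

/-- LOCAL DATA of a configuration: label, internal state and the top-`D` cells of every stack
(a finite type). [folklore] -/
abbrev LocalData : Type := Option tm.Λ × tm.σ × (∀ k : tm.K, Fin (D tm) → Option (Sym tm k))

/-- Local data form a finite type. [folklore] -/
instance : Finite (LocalData tm) := inferInstance

/-- The local data of a configuration. [folklore] -/
noncomputable def ld (c : tm.Cfg) : LocalData tm := (c.l, c.var, fun k j => cell tm c k j)

/-- The window list described by a column of local data (the `some` entries, in order). [folklore] -/
noncomputable def winList {k : tm.K} (f : Fin (D tm) → Option (Sym tm k)) : List (tm.Γ k) :=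
  (List.ofFn f).filterMap fun o => o.map Subtype.val

/-- The truncated configuration described by local data. [folklore] -/
noncomputable def ofLD (w : LocalData tm) : tm.Cfg := ⟨w.1, w.2.1, fun k => winList tm (w.2.2 k)⟩

/-- Reading off the defined entries of `l[0]?, …, l[n-1]?` gives `l.take n`. [folklore] -/
theorem filterMap_ofFn_getElem? {α : Type} : ∀ (n : ℕ) (l : List α),
    (List.ofFn fun j : Fin n => l[(j : ℕ)]?).filterMap id = l.take n
  | 0, l => by simp
  | n + 1, [] => by simp
  | n + 1, a :: l => by
    rw [List.ofFn_succ]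
    simp only [Fin.val_zero, List.getElem?_cons_zero, Fin.val_succ, List.getElem?_cons_succ,
      List.take_succ_cons]
    rw [List.filterMap_cons_some (f := id) (a := some a) (b := a) rfl, filterMap_ofFn_getElem? n l]

/-- The window list of the cells of a good configuration is the top-`D` segment of the stack. [folklore] -/
theorem filterMap_ofFn_cell {c : tm.Cfg} (hc : TM2Sim.Good tm c) (k : tm.K) :
    (List.ofFn fun j : Fin (D tm) => cell tm c k j).filterMap (fun o => o.map Subtype.val) =
      (c.stk k).take (D tm) := by
  have : (fun o : Option (Sym tm k) => o.map Subtype.val) = id ∘ fun o : Option (Sym tm k) => o.map Subtype.val := rfl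
  rw [this, ← List.filterMap_map, List.map_ofFn]
  have h2 : ((fun o : Option (Sym tm k) => o.map Subtype.val) ∘ fun j : Fin (D tm) => cell tm c k j) =
      fun j : Fin (D tm) => (c.stk k)[(j : ℕ)]? := by
    funext j; exact cell_eq_of_good tm hc k j
  rw [h2, filterMap_ofFn_getElem?]

/-- The configuration described by the local data of a good configuration is its truncation to the windows. [folklore] -/
theorem ofLD_ld {c : tm.Cfg} (hc : TM2Sim.Good tm c) : ofLD tm (ld tm c) = TM2Sim.truncate tm (D tm) c := by
  simp only [ofLD, ld, TM2Sim.truncate, winList]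
  congr 1
  funext k
  exact filterMap_ofFn_cell tm hc k


/-- Local data describe good configurations (their window symbols are effective). [folklore] -/
theorem good_ofLD (w : LocalData tm) : TM2Sim.Good tm (ofLD tm w) := by
  intro k γ hγ
  simp only [ofLD, winList, List.mem_filterMap, List.mem_ofFn] at hγ
  obtain ⟨o, -, ho⟩ := hγ
  cases o with
  | none => cases ho
  | some s => cases ho; exact s.2

/-- The NEXT-STEP data of local data: one machine step on the truncated configuration. Its label
and state are those after the step, its stacks the new windows `W'_k` (`|W'_k| ≤ 2D`). [folklore] -/
noncomputable def next (w : LocalData tm) : tm.Cfg := TM2Sim.stepTotal tm (ofLD tm w)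

/-- Next-step data are good. [folklore] -/
theorem good_next (w : LocalData tm) : TM2Sim.Good tm (next tm w) :=
  (good_ofLD tm w).stepTotal

/-- The new windows have length at most `2D`. [folklore] -/
theorem length_next_stk_le (w : LocalData tm) (k : tm.K) : ((next tm w).stk k).length ≤ 2 * D tm := by
  have h1 : ((ofLD tm w).stk k).length ≤ D tm := by
    simp only [ofLD, winList]
    exact (List.length_filterMap_le _ _).trans (by simp)
  have h2 := TM2Sim.length_stepTotal_le tm (ofLD tm w) k
  have h3 : D tm = TM2Sim.depth tm := rfl
  unfold next; omega

/-- The step on the truncated configuration is the next-step data of the local data. [folklore] -/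
theorem stepTotal_truncate_eq_next {c : tm.Cfg} (hc : TM2Sim.Good tm c) :
    TM2Sim.stepTotal tm (TM2Sim.truncate tm (D tm) c) = next tm (ld tm c) := by
  rw [next, ofLD_ld tm hc]

/-- The control after a step is the control of the next-step data of the local data. [folklore] -/
theorem ctrl_stepTotal {c : tm.Cfg} (hc : TM2Sim.Good tm c) :
    (TM2Sim.stepTotal tm c).l = (next tm (ld tm c)).l ∧
      (TM2Sim.stepTotal tm c).var = (next tm (ld tm c)).var := by
  rw [TM2Sim.stepTotal_window tm c (D tm) le_rfl, ← stepTotal_truncate_eq_next tm hc]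
  exact ⟨rfl, rfl⟩

/-- **The cells after a step**: the new window on top, the old cells shifted below it. [folklore] -/
theorem cell_stepTotal {c : tm.Cfg} (hc : TM2Sim.Good tm c) (k : tm.K) (j : ℕ) :
    cell tm (TM2Sim.stepTotal tm c) k j =
      if j < ((next tm (ld tm c)).stk k).length then (((next tm (ld tm c)).stk k)[j]?).bind (toSym tm k)
      else cell tm c k (j - ((next tm (ld tm c)).stk k).length + D tm) := by
  rw [cell_def]
  rw [TM2Sim.getElem?_stepTotal_stk tm c (D tm) le_rfl k j, stepTotal_truncate_eq_next tm hc]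
  split <;> rfl

/-- The cells of the new window are effective symbols. [folklore] -/
theorem next_stk_getElem?_bind (w : LocalData tm) (k : tm.K) {j : ℕ} (hj : j < ((next tm w).stk k).length) :
    ∃ s : Sym tm k, (((next tm w).stk k)[j]?).bind (toSym tm k) = some s ∧
      ((next tm w).stk k)[j]? = some s.val := by
  have hγ : TM2Sim.IsSym tm k (((next tm w).stk k)[j]) := good_next tm w k _ (List.getElem_mem hj)
  refine ⟨⟨_, hγ⟩, ?_, ?_⟩
  · rw [List.getElem?_eq_getElem hj, Option.bind_some, toSym_of_isSym tm hγ]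
  · rw [List.getElem?_eq_getElem hj]

/-- The initial configuration: control. [folklore] -/
theorem initList_l_var (s : List (tm.Γ tm.k₀)) :
    (initList tm s).l = some tm.main ∧ (initList tm s).var = tm.initialState := ⟨rfl, rfl⟩

/-- The initial configuration: cells of the input stack. [folklore] -/
theorem cell_initList_k₀ (s : List (tm.Γ tm.k₀)) (j : ℕ) :
    cell tm (initList tm s) tm.k₀ j = (s[j]?).map fun γ => (⟨γ, Or.inr rfl⟩ : Sym tm tm.k₀) := by
  rw [cell_def]
  rw [TM2Comp.initList_eq]
  simp only [Function.update_self]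
  rcases s[j]? with _ | γ
  · rfl
  · rw [Option.bind_some, toSym_of_isSym tm (Or.inr rfl : TM2Sim.IsSym tm tm.k₀ γ)]
    rfl

/-- The initial configuration: the other stacks are empty. [folklore] -/
theorem cell_initList_ne (s : List (tm.Γ tm.k₀)) {k : tm.K} (hk : k ≠ tm.k₀) (j : ℕ) :
    cell tm (initList tm s) k j = none := by
  rw [cell_def]
  rw [TM2Comp.initList_eq]
  simp only [Function.update_of_ne hk, List.getElem?_nil, Option.bind_none]

/-- A halted configuration is fixed by all later iterates. [folklore] -/
theorem iterate_fixed_of_halted (c₀ : tm.Cfg) {t : ℕ} (ht : ((TM2Sim.stepTotal tm)^[t] c₀).l = none)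
    (t' : ℕ) (htt' : t ≤ t') : (TM2Sim.stepTotal tm)^[t'] c₀ = (TM2Sim.stepTotal tm)^[t] c₀ := by
  obtain ⟨e, rfl⟩ := Nat.exists_eq_add_of_le htt'
  rw [Nat.add_comm, Function.iterate_add_apply, TM2Sim.iterate_stepTotal_of_none tm ht]


/-! ### Contents of facts and their codes -/

/-- CONTENTS of a fact of the simulation: either a control `(label, state)` (recorded at position
`0`) or, for a stack `k`, the content of a cell (an effective symbol or blank). [folklore] -/
abbrev Content : Type := (Option tm.Λ × tm.σ) ⊕ (Σ k : tm.K, Option (Sym tm k))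

/-- Contents form a finite type. [folklore] -/
instance : Finite (Content tm) := inferInstance

/-- The length of the one-hot code of contents. [folklore] -/
noncomputable def cM : ℕ := Nat.card (Content tm)

/-- The one-hot code of a content. [folklore] -/
noncomputable def ccode (x : Content tm) : Fin (cM tm) → Bool :=
  fun l => decide (Finite.equivFin (Content tm) x = l)

/-- The one-hot code of contents is injective. [folklore] -/
theorem ccode_injective : Function.Injective (ccode tm) := by
  intro x y h
  have := congrFun h (Finite.equivFin (Content tm) x)
  simp only [ccode, decide_true, true_eq_decide_iff] at this
  exact (Finite.equivFin (Content tm)).injective this.symm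

variable {tm}

/-- The arity of the fact relation: time tuple, position tuple, content code. [folklore] -/
abbrev A (tm : FinTM2) (d : ℕ) : ℕ := d + d + cM tm

section Blocks

variable {d : ℕ} {N : ℕ}

/-- Time block of a fact tuple. [folklore] -/
def timeOf (a : Fin (A tm d) → Fin N) : Fin d → Fin N := a ∘ Fin.castAdd (cM tm) ∘ Fin.castAdd d
/-- Position block of a fact tuple. [folklore] -/
def posOf (a : Fin (A tm d) → Fin N) : Fin d → Fin N := a ∘ Fin.castAdd (cM tm) ∘ Fin.natAdd d
/-- Content block of a fact tuple. [folklore] -/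
def contOf (a : Fin (A tm d) → Fin N) : Fin (cM tm) → Fin N := a ∘ Fin.natAdd (d + d)

/-- Assembling a fact tuple. [folklore] -/
def mkFact (t p : Fin d → Fin N) (e : Fin (cM tm) → Fin N) : Fin (A tm d) → Fin N :=
  Fin.append (Fin.append t p) e

/-- Time block of an assembled fact. [folklore] -/
@[simp] theorem timeOf_mkFact (t p : Fin d → Fin N) (e : Fin (cM tm) → Fin N) :
    timeOf (mkFact (tm := tm) t p e) = t := by
  funext i; simp only [timeOf, mkFact, Function.comp_apply, Fin.append_left]
/-- Position block of an assembled fact. [folklore] -/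
@[simp] theorem posOf_mkFact (t p : Fin d → Fin N) (e : Fin (cM tm) → Fin N) :
    posOf (mkFact (tm := tm) t p e) = p := by
  funext i; simp only [posOf, mkFact, Function.comp_apply, Fin.append_left, Fin.append_right]
/-- Content block of an assembled fact. [folklore] -/
@[simp] theorem contOf_mkFact (t p : Fin d → Fin N) (e : Fin (cM tm) → Fin N) :
    contOf (mkFact (tm := tm) t p e) = e := by
  funext i; simp only [contOf, mkFact, Function.comp_apply, Fin.append_right]
/-- A fact tuple is assembled from its blocks. [folklore] -/
theorem mkFact_eta (a : Fin (A tm d) → Fin N) : mkFact (timeOf a) (posOf a) (contOf a) = a := by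
  funext i
  refine Fin.addCases (fun i => ?_) (fun i => ?_) i
  · refine Fin.addCases (fun i => ?_) (fun i => ?_) i <;>
      simp only [mkFact, timeOf, posOf, Fin.append_left, Fin.append_right, Function.comp_apply]
  · simp only [mkFact, contOf, Fin.append_right, Function.comp_apply]

end Blocks

/-! ### The formulas -/

section Formulas

variable {ar : List ℕ} {d : ℕ} {rv' : List ℕ} {m : ℕ}

/-- `X(t̄, p̄, code x)` for variable tuples `t̄, p̄`. [folklore] -/
noncomputable def factV (t p : Fin d → Fin m) (x : Content tm) : Formula (2 :: ar) (A tm d :: rv') m :=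
  Formula.exs (cM tm) (.and (Formula.isCode (ccode tm x) (Fin.natAdd m))
    (Formula.rv0 (Fin.append (Fin.append (Fin.castAdd (cM tm) ∘ t) (Fin.castAdd (cM tm) ∘ p)) (Fin.natAdd m))))

/-- `X(t̄, j₀, code x)` for a numeral position `j₀`. [folklore] -/
noncomputable def factC (t : Fin d → Fin m) (j₀ : ℕ) (x : Content tm) : Formula (2 :: ar) (A tm d :: rv') m :=
  Formula.exs d (.and (Formula.isConstT j₀ (Fin.natAdd m)) (factV (Fin.castAdd d ∘ t) (Fin.natAdd m) x))

variable {N : ℕ} (R : RelTables ar N) (V' : RVAssign rv' N) (S : Set (Fin (A tm d) → Fin N))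
  (τ : Fin m → Fin N) (hN : 1 ≤ N)

/-- Semantics of `factV`. [folklore] -/
theorem eval_factV (t p : Fin d → Fin m) (x : Content tm) :
    (factV t p x : Formula (2 :: ar) (A tm d :: rv') m).eval (withNatOrder R) (RVAssign.cons S V') τ ↔
      mkFact (τ ∘ t) (τ ∘ p) (codeVal N hN (ccode tm x)) ∈ S := by
  simp only [factV, Formula.eval_exs, Formula.eval_and', Formula.eval_isCode R _ _ hN, Formula.eval_rv0,
    append_comp_natAdd]
  have e1 : ∀ b : Fin (cM tm) → Fin N, Fin.append τ b ∘
      Fin.append (Fin.append (Fin.castAdd (cM tm) ∘ t) (Fin.castAdd (cM tm) ∘ p)) (Fin.natAdd m) =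
        mkFact (τ ∘ t) (τ ∘ p) b := by
    intro b; funext i
    refine Fin.addCases (fun i => ?_) (fun i => ?_) i
    · refine Fin.addCases (fun i => ?_) (fun i => ?_) i <;>
        simp only [mkFact, Fin.append_left, Fin.append_right, Function.comp_apply]
    · simp only [mkFact, Fin.append_right, Function.comp_apply]
  simp only [e1]
  constructor
  · rintro ⟨b, rfl, h⟩; exact h
  · intro h; exact ⟨_, rfl, h⟩

/-- Semantics of `factC`. [folklore] -/
theorem eval_factC (t : Fin d → Fin m) (j₀ : ℕ) (x : Content tm) :
    (factC t j₀ x : Formula (2 :: ar) (A tm d :: rv') m).eval (withNatOrder R) (RVAssign.cons S V') τ ↔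
      ∃ pv : Fin d → Fin N, tval pv = j₀ ∧ mkFact (τ ∘ t) pv (codeVal N hN (ccode tm x)) ∈ S := by
  simp only [factC, Formula.eval_exs, Formula.eval_and', Formula.eval_isConstT, eval_factV R V' S _ hN,
    append_comp_natAdd, append_comp_castAdd]

end Formulas


section Formulas2

variable {ar : List ℕ} {d : ℕ} {rv' : List ℕ} {m : ℕ}

/-- `tval p̄₂ + L = tval p̄ + D` (the source cell of a shifted cell). [folklore] -/
def shiftRel (tm : FinTM2) (L : ℕ) (p p₂ : Fin d → Fin m) : Formula (2 :: ar) rv' m :=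
  if L ≤ D tm then Formula.shiftT (D tm - L) p p₂ else Formula.shiftT (L - D tm) p₂ p

/-- Conclusion clause for the cells of stack `k` after a step with local data `w`. [folklore] -/
def conclCell (w : LocalData tm) (k : tm.K) (t p : Fin d → Fin m) (e : Fin (cM tm) → Fin m) :
    Formula (2 :: ar) (A tm d :: rv') m :=
  let W := (next tm w).stk k
  let L := W.length
  .or (Formula.iOr fun j : Fin L => .and (Formula.isConstT j p)
        (Formula.isCode (ccode tm (Sum.inr ⟨k, (W[(j : ℕ)]?).bind (toSym tm k)⟩)) e))
    (.and (.not (Formula.iOr fun j : Fin L => Formula.isConstT j p))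
      (.or (Formula.exs d (.and (shiftRel tm L (Fin.castAdd d ∘ p) (Fin.natAdd m))
              (Formula.fOr fun γ : Option (Sym tm k) =>
                .and (Formula.isCode (ccode tm (Sum.inr ⟨k, γ⟩)) (Fin.castAdd d ∘ e))
                  (factV (Fin.castAdd d ∘ t) (Fin.natAdd m) (Sum.inr ⟨k, γ⟩)))))
        (.and (.not (Formula.exs d (shiftRel tm L (Fin.castAdd d ∘ p) (Fin.natAdd m))))
          (Formula.isCode (ccode tm (Sum.inr ⟨k, none⟩)) e))))

/-- Conclusion clause: the facts at the next time, given the local data `w` at time `t̄`. [folklore] -/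
def conclW (w : LocalData tm) (t p : Fin d → Fin m) (e : Fin (cM tm) → Fin m) :
    Formula (2 :: ar) (A tm d :: rv') m :=
  .or (.and (Formula.zeroT p) (Formula.isCode (ccode tm (Sum.inl ((next tm w).l, (next tm w).var))) e))
    (Formula.fOr fun k : tm.K => conclCell w k t p e)

/-- "The facts at time `t̄` exhibit the local data `w`." [folklore] -/
def matchesW (w : LocalData tm) (t : Fin d → Fin m) : Formula (2 :: ar) (A tm d :: rv') m :=
  .and (factC t 0 (Sum.inl (w.1, w.2.1)))
    (Formula.fAnd fun k : tm.K => Formula.iAnd fun j : Fin (D tm) => factC t j (Sum.inr ⟨k, w.2.2 k j⟩))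

/-- The input symbol of a bit, as an effective symbol of the input stack. [folklore] -/
def inSym (tm : FinTM2) (sy : Bool → tm.Γ tm.k₀) (b : Bool) : Sym tm tm.k₀ := ⟨sy b, Or.inr rfl⟩

/-- The facts at time `0`: the initial configuration on the input word. [folklore] -/
def initF (inLen inTrue : TBuilder ar 0 d) (sy : Bool → tm.Γ tm.k₀) (t p : Fin d → Fin m)
    (e : Fin (cM tm) → Fin m) : Formula (2 :: ar) (A tm d :: rv') m :=
  .and (Formula.zeroT t)
    (.or (.and (Formula.zeroT p) (Formula.isCode (ccode tm (Sum.inl (some tm.main, tm.initialState))) e))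
      (.or
        (.or (.and (inTrue Fin.elim0 p) (Formula.isCode (ccode tm (Sum.inr ⟨tm.k₀, some (inSym tm sy true)⟩)) e))
          (.or (.and (inLen Fin.elim0 p) (.and (.not (inTrue Fin.elim0 p))
                  (Formula.isCode (ccode tm (Sum.inr ⟨tm.k₀, some (inSym tm sy false)⟩)) e)))
            (.and (.not (inLen Fin.elim0 p)) (Formula.isCode (ccode tm (Sum.inr ⟨tm.k₀, none⟩)) e))))
        (Formula.fOr fun k : tm.K =>
          if k = tm.k₀ then Formula.falsum else Formula.isCode (ccode tm (Sum.inr ⟨k, none⟩)) e)))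

/-- **The body of the simulation induction.** [cite: Gurevich1984, §4 Theorems 2–3 ((1)→(3))] -/
def simBody (inLen inTrue : TBuilder ar 0 d) (sy : Bool → tm.Γ tm.k₀) :
    Formula (2 :: ar) (A tm d :: rv') (m + A tm d) :=
  let t : Fin d → Fin (m + A tm d) := Fin.natAdd m ∘ Fin.castAdd (cM tm) ∘ Fin.castAdd d
  let p : Fin d → Fin (m + A tm d) := Fin.natAdd m ∘ Fin.castAdd (cM tm) ∘ Fin.natAdd d
  let e : Fin (cM tm) → Fin (m + A tm d) := Fin.natAdd m ∘ Fin.natAdd (d + d)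
  .or (initF inLen inTrue sy t p e)
    (Formula.exs d (.and (Formula.succT (Fin.natAdd (m + A tm d)) (Fin.castAdd d ∘ t))
      (Formula.fOr fun w : LocalData tm =>
        .and (matchesW w (Fin.natAdd (m + A tm d)))
          (conclW w (Fin.natAdd (m + A tm d)) (Fin.castAdd d ∘ p) (Fin.castAdd d ∘ e)))))

/-- **The fact relation of the computation** `Conf(t̄, p̄, ē)`. [cite: Gurevich1984, §4 Theorems 2–3 ((1)→(3))] -/
def confRel (inLen inTrue : TBuilder ar 0 d) (sy : Bool → tm.Γ tm.k₀) (t p : Fin d → Fin m)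
    (e : Fin (cM tm) → Fin m) : Formula (2 :: ar) rv' m :=
  .fp (A tm d) (simBody inLen inTrue sy) (Fin.append (Fin.append t p) e)

/-! #### Semantic counterparts -/

variable {N : ℕ} (hN : 1 ≤ N) (S : Set (Fin (A tm d) → Fin N))

/-- Semantic matching. [folklore] -/
def MatchSem (tv : Fin d → Fin N) (w : LocalData tm) : Prop :=
  (∃ pv : Fin d → Fin N, tval pv = 0 ∧ mkFact tv pv (codeVal N hN (ccode tm (Sum.inl (w.1, w.2.1)))) ∈ S) ∧
    ∀ (k : tm.K) (j : Fin (D tm)), ∃ pv : Fin d → Fin N, tval pv = j ∧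
      mkFact tv pv (codeVal N hN (ccode tm (Sum.inr ⟨k, w.2.2 k j⟩))) ∈ S

/-- Semantic conclusion for the cells of stack `k`. [folklore] -/
def ConclCellSem (w : LocalData tm) (k : tm.K) (tv pv : Fin d → Fin N) (ev : Fin (cM tm) → Fin N) : Prop :=
  let W := (next tm w).stk k
  let L := W.length
  (∃ j : Fin L, tval pv = j ∧ ev = codeVal N hN (ccode tm (Sum.inr ⟨k, (W[(j : ℕ)]?).bind (toSym tm k)⟩))) ∨
    ((¬ ∃ j : Fin L, tval pv = j) ∧
      ((∃ p₂ : Fin d → Fin N, tval p₂ + L = tval pv + D tm ∧ ∃ γ : Option (Sym tm k),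
          ev = codeVal N hN (ccode tm (Sum.inr ⟨k, γ⟩)) ∧ mkFact tv p₂ (codeVal N hN (ccode tm (Sum.inr ⟨k, γ⟩))) ∈ S) ∨
        ((¬ ∃ p₂ : Fin d → Fin N, tval p₂ + L = tval pv + D tm) ∧
          ev = codeVal N hN (ccode tm (Sum.inr ⟨k, none⟩)))))

/-- Semantic conclusion. [folklore] -/
def ConclSem (w : LocalData tm) (tv pv : Fin d → Fin N) (ev : Fin (cM tm) → Fin N) : Prop :=
  (tval pv = 0 ∧ ev = codeVal N hN (ccode tm (Sum.inl ((next tm w).l, (next tm w).var)))) ∨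
    ∃ k, ConclCellSem hN S w k tv pv ev

/-- Semantic initial facts, for the input word `u`. [folklore] -/
def InitSem (u : List Bool) (sy : Bool → tm.Γ tm.k₀) (tv pv : Fin d → Fin N) (ev : Fin (cM tm) → Fin N) : Prop :=
  tval tv = 0 ∧
    ((tval pv = 0 ∧ ev = codeVal N hN (ccode tm (Sum.inl (some tm.main, tm.initialState)))) ∨
      ((u[tval pv]? = some true ∧ ev = codeVal N hN (ccode tm (Sum.inr ⟨tm.k₀, some (inSym tm sy true)⟩))) ∨
        (tval pv < u.length ∧ ¬ u[tval pv]? = some true ∧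
            ev = codeVal N hN (ccode tm (Sum.inr ⟨tm.k₀, some (inSym tm sy false)⟩))) ∨
        (¬ tval pv < u.length ∧ ev = codeVal N hN (ccode tm (Sum.inr ⟨tm.k₀, none⟩)))) ∨
      ∃ k : tm.K, k ≠ tm.k₀ ∧ ev = codeVal N hN (ccode tm (Sum.inr ⟨k, none⟩)))

/-- The semantic operator of the simulation induction. [folklore] -/
def FSem (u : List Bool) (sy : Bool → tm.Γ tm.k₀) (a : Fin (A tm d) → Fin N) : Prop :=
  InitSem hN u sy (timeOf a) (posOf a) (contOf a) ∨
    ∃ t₀ : Fin d → Fin N, tval (timeOf a) = tval t₀ + 1 ∧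
      ∃ w : LocalData tm, MatchSem hN S t₀ w ∧ ConclSem hN S w t₀ (posOf a) (contOf a)

/-! #### Evaluation lemmas -/

variable (R : RelTables ar N) (V' : RVAssign rv' N) (τ : Fin m → Fin N)

/-- Semantics of `shiftRel L`: `tval p̄₂ + L = tval p̄ + D` (both orientations of the shift). [folklore] -/
theorem eval_shiftRel (L : ℕ) (p p₂ : Fin d → Fin m) :
    (shiftRel tm L p p₂ : Formula (2 :: ar) rv' m).eval (withNatOrder R) V' τ ↔
      tval (τ ∘ p₂) + L = tval (τ ∘ p) + D tm := by
  unfold shiftRel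
  split <;> simp <;> omega

/-- Semantics of `conclCell`. [folklore] -/
theorem eval_conclCell (w : LocalData tm) (k : tm.K) (t p : Fin d → Fin m) (e : Fin (cM tm) → Fin m) :
    (conclCell w k t p e : Formula (2 :: ar) (A tm d :: rv') m).eval (withNatOrder R) (RVAssign.cons S V') τ ↔
      ConclCellSem hN S w k (τ ∘ t) (τ ∘ p) (τ ∘ e) := by
  simp only [conclCell, ConclCellSem, Formula.eval_or', Formula.eval_and', Formula.eval_not',
    Formula.eval_iOr, Formula.eval_isConstT, Formula.eval_isCode R _ _ hN, Formula.eval_exs,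
    eval_shiftRel, Formula.eval_fOr, eval_factV R V' S _ hN, append_comp_castAdd, append_comp_natAdd]

/-- Semantics of `conclW`. [folklore] -/
theorem eval_conclW (w : LocalData tm) (t p : Fin d → Fin m) (e : Fin (cM tm) → Fin m) :
    (conclW w t p e : Formula (2 :: ar) (A tm d :: rv') m).eval (withNatOrder R) (RVAssign.cons S V') τ ↔
      ConclSem hN S w (τ ∘ t) (τ ∘ p) (τ ∘ e) := by
  simp only [conclW, ConclSem, Formula.eval_or', Formula.eval_and', Formula.eval_zeroT,
    Formula.eval_isCode R _ _ hN, Formula.eval_fOr, eval_conclCell hN S R V' τ]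

/-- Semantics of `matchesW`. [folklore] -/
theorem eval_matchesW (w : LocalData tm) (t : Fin d → Fin m) :
    (matchesW w t : Formula (2 :: ar) (A tm d :: rv') m).eval (withNatOrder R) (RVAssign.cons S V') τ ↔
      MatchSem hN S (τ ∘ t) w := by
  simp only [matchesW, MatchSem, Formula.eval_and', eval_factC R V' S _ hN, Formula.eval_fAnd,
    Formula.eval_iAnd]

/-- Semantics of `initF`, given builders realising the input word `u`. [folklore] -/
theorem eval_initF {inLen inTrue : TBuilder ar 0 d} {u : List Bool}
    (hLen : TBuilder.Realizes R inLen fun _ pv => tval pv < u.length)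
    (hTrue : TBuilder.Realizes R inTrue fun _ pv => u[tval pv]? = some true)
    (sy : Bool → tm.Γ tm.k₀) (t p : Fin d → Fin m) (e : Fin (cM tm) → Fin m) :
    (initF inLen inTrue sy t p e : Formula (2 :: ar) (A tm d :: rv') m).eval (withNatOrder R)
        (RVAssign.cons S V') τ ↔ InitSem hN u sy (τ ∘ t) (τ ∘ p) (τ ∘ e) := by
  simp only [initF, InitSem, Formula.eval_and', Formula.eval_or', Formula.eval_not', Formula.eval_zeroT,
    Formula.eval_isCode R _ _ hN, hLen, hTrue, Formula.eval_fOr]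
  refine and_congr_right fun _ => or_congr_right (or_congr_right (exists_congr fun k => ?_))
  by_cases hk : k = tm.k₀ <;> simp [hk, Formula.eval_isCode R _ _ hN]


/-- Semantics of the body of the simulation induction: the semantic operator `FSem`. [folklore] -/
theorem eval_simBody {inLen inTrue : TBuilder ar 0 d} {u : List Bool}
    (hLen : TBuilder.Realizes R inLen fun _ pv => tval pv < u.length)
    (hTrue : TBuilder.Realizes R inTrue fun _ pv => u[tval pv]? = some true)
    (sy : Bool → tm.Γ tm.k₀) (σ : Fin m → Fin N) (a : Fin (A tm d) → Fin N) :
    (simBody inLen inTrue sy : Formula (2 :: ar) (A tm d :: rv') (m + A tm d)).eval (withNatOrder R)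
        (RVAssign.cons S V') (Fin.append σ a) ↔ FSem hN S u sy a := by
  simp only [simBody, FSem, Formula.eval_or', Formula.eval_and', eval_initF hN S R _ _ hLen hTrue,
    Formula.eval_exs, Formula.eval_succT, Formula.eval_fOr, eval_matchesW hN S R, eval_conclW hN S R]
  have e1 : Fin.append σ a ∘ (Fin.natAdd m ∘ Fin.castAdd (cM tm) ∘ Fin.castAdd d) = timeOf a := by
    funext i; simp only [timeOf, Function.comp_apply, Fin.append_right]
  have e2 : Fin.append σ a ∘ (Fin.natAdd m ∘ Fin.castAdd (cM tm) ∘ Fin.natAdd d) = posOf a := by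
    funext i; simp only [posOf, Function.comp_apply, Fin.append_right]
  have e3 : Fin.append σ a ∘ (Fin.natAdd m ∘ Fin.natAdd (d + d)) = contOf a := by
    funext i; simp only [contOf, Function.comp_apply, Fin.append_right]
  have e4 : ∀ b : Fin d → Fin N, Fin.append (Fin.append σ a) b ∘ Fin.natAdd (m + A tm d) = b := by
    intro b; funext i; simp only [Function.comp_apply, Fin.append_right]
  have e5 : ∀ b : Fin d → Fin N, Fin.append (Fin.append σ a) b ∘
      (Fin.castAdd d ∘ (Fin.natAdd m ∘ Fin.castAdd (cM tm) ∘ Fin.castAdd d)) = timeOf a := by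
    intro b; funext i; simp only [timeOf, Function.comp_apply, Fin.append_left, Fin.append_right]
  have e6 : ∀ b : Fin d → Fin N, Fin.append (Fin.append σ a) b ∘
      (Fin.castAdd d ∘ (Fin.natAdd m ∘ Fin.castAdd (cM tm) ∘ Fin.natAdd d)) = posOf a := by
    intro b; funext i; simp only [posOf, Function.comp_apply, Fin.append_left, Fin.append_right]
  have e7 : ∀ b : Fin d → Fin N, Fin.append (Fin.append σ a) b ∘
      (Fin.castAdd d ∘ (Fin.natAdd m ∘ Fin.natAdd (d + d))) = contOf a := by
    intro b; funext i; simp only [contOf, Function.comp_apply, Fin.append_left, Fin.append_right]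
  simp only [e1, e2, e3, e4, e5, e6, e7]

end Formulas2

/-! ### The intended fact set of a run and the correctness of the induction -/

section Correctness

variable {d N : ℕ} (hN : 1 ≤ N)

/-- The run from `c₀`. [folklore] -/
def run (tm : FinTM2) (c₀ : tm.Cfg) (t : ℕ) : tm.Cfg := (TM2Sim.stepTotal tm)^[t] c₀

/-- One more step of the run. [folklore] -/
theorem run_succ (c₀ : tm.Cfg) (t : ℕ) : run tm c₀ (t + 1) = TM2Sim.stepTotal tm (run tm c₀ t) :=
  Function.iterate_succ_apply' _ _ _

/-- Runs from good configurations stay good. [folklore] -/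
theorem good_run {c₀ : tm.Cfg} (h : TM2Sim.Good tm c₀) (t : ℕ) : TM2Sim.Good tm (run tm c₀ t) :=
  TM2Sim.Good.iterate tm h t

/-- A halted run stays put. [folklore] -/
theorem run_fixed_of_halted (c₀ : tm.Cfg) {t : ℕ} (ht : (run tm c₀ t).l = none) (t' : ℕ) (htt' : t ≤ t') :
    run tm c₀ t' = run tm c₀ t :=
  iterate_fixed_of_halted tm c₀ ht t' htt'

/-- What a content asserts about the run at time `t`, position `j`. [folklore] -/
def Holds (c₀ : tm.Cfg) : Content tm → ℕ → ℕ → Prop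
  | Sum.inl q, t, j => j = 0 ∧ (run tm c₀ t).l = q.1 ∧ (run tm c₀ t).var = q.2
  | Sum.inr ⟨k, γ⟩, t, j => cell tm (run tm c₀ t) k j = γ

/-- **The intended fact set**: codes of true contents. [cite: Gurevich1984, §4 Theorems 2–3 ((1)→(3))] -/
def Conf (c₀ : tm.Cfg) : Set (Fin (A tm d) → Fin N) :=
  {a | ∃ x : Content tm, contOf a = codeVal N hN (ccode tm x) ∧ Holds c₀ x (tval (timeOf a)) (tval (posOf a))}

variable {hN}

/-- A coded fact lies in the intended fact set iff its content holds (code injectivity, `N ≥ 2`). [folklore] -/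
theorem mkFact_mem_conf_iff (hN2 : 2 ≤ N) (c₀ : tm.Cfg) (tv pv : Fin d → Fin N) (x : Content tm) :
    mkFact tv pv (codeVal N hN (ccode tm x)) ∈ Conf hN c₀ ↔ Holds c₀ x (tval tv) (tval pv) := by
  simp only [Conf, Set.mem_setOf_eq, contOf_mkFact, timeOf_mkFact, posOf_mkFact]
  constructor
  · rintro ⟨y, hy, h⟩
    have : x = y := ccode_injective tm (codeVal_injective (by omega) hy)
    subst this; exact h
  · intro h; exact ⟨x, rfl, h⟩

/-- Unfolding membership in the intended fact set. [folklore] -/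
theorem mem_conf_iff (c₀ : tm.Cfg) (a : Fin (A tm d) → Fin N) :
    a ∈ Conf hN c₀ ↔ ∃ x : Content tm, contOf a = codeVal N hN (ccode tm x) ∧
      Holds c₀ x (tval (timeOf a)) (tval (posOf a)) := Iff.rfl

/-- Matching against sound facts pins down the local data of the configuration. [folklore] -/
theorem eq_ld_of_matchSem (hN2 : 2 ≤ N) {c₀ : tm.Cfg} {S : Set (Fin (A tm d) → Fin N)}
    (hS : S ⊆ Conf hN c₀) {tv : Fin d → Fin N} {w : LocalData tm} (h : MatchSem hN S tv w) :
    w = ld tm (run tm c₀ (tval tv)) := by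
  obtain ⟨⟨pv, hpv, hctrl⟩, hcells⟩ := h
  have h1 := (mkFact_mem_conf_iff hN2 c₀ tv pv _).mp (hS hctrl)
  simp only [Holds] at h1
  obtain ⟨-, hl, hvar⟩ := h1
  obtain ⟨l, v, win⟩ := w
  simp only [ld, Prod.mk.injEq]
  refine ⟨hl.symm, hvar.symm, funext fun k => funext fun j => ?_⟩
  obtain ⟨pv', hpv', hc⟩ := hcells k j
  have h2 := (mkFact_mem_conf_iff hN2 c₀ tv pv' _).mp (hS hc)
  simp only [Holds] at h2
  rw [← h2, hpv']

/-- The true local data match, given all facts of that time. [folklore] -/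
theorem matchSem_ld (hDd : D tm < N ^ d) {c₀ : tm.Cfg} {S : Set (Fin (A tm d) → Fin N)}
    {tv : Fin d → Fin N}
    (hS : ∀ (pv : Fin d → Fin N) (x : Content tm), Holds c₀ x (tval tv) (tval pv) →
      mkFact tv pv (codeVal N hN (ccode tm x)) ∈ S) :
    MatchSem hN S tv (ld tm (run tm c₀ (tval tv))) := by
  constructor
  · obtain ⟨pv, hpv⟩ := exists_tval_eq (N := N) (d := d) (m := 0) (by omega)
    exact ⟨pv, hpv, hS pv _ (by simp [Holds, ld, hpv])⟩
  · intro k j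
    obtain ⟨pv, hpv⟩ := exists_tval_eq (N := N) (d := d) (m := j) (by omega)
    exact ⟨pv, hpv, hS pv _ (by simp [Holds, ld, hpv])⟩


/-! #### Initial facts -/

/-- The input stack of the initial configuration holds the input word, bit by bit. [folklore] -/
theorem cell_init_k₀ (u : List Bool) (sy : Bool → tm.Γ tm.k₀) (j : ℕ) :
    cell tm (initList tm (u.map sy)) tm.k₀ j = (u[j]?).map (inSym tm sy) := by
  rw [cell_initList_k₀, List.getElem?_map, Option.map_map]; rfl

/-- The run at time `0`. [folklore] -/
theorem run_zero (c₀ : tm.Cfg) : run tm c₀ 0 = c₀ := rfl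

/-- Soundness of the initial clause: it only produces true facts about time `0`. [folklore] -/
theorem initSem_sound {u : List Bool} {sy : Bool → tm.Γ tm.k₀} {tv pv : Fin d → Fin N}
    {ev : Fin (cM tm) → Fin N} (h : InitSem hN u sy tv pv ev) :
    mkFact tv pv ev ∈ Conf hN (initList tm (u.map sy)) := by
  obtain ⟨ht, h⟩ := h
  simp only [mem_conf_iff, contOf_mkFact, timeOf_mkFact, posOf_mkFact, ht]
  rcases h with ⟨hp, rfl⟩ | (⟨hu, rfl⟩ | ⟨hlt, hu, rfl⟩ | ⟨hge, rfl⟩) | ⟨k, hk, rfl⟩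
  · exact ⟨_, rfl, hp, rfl, rfl⟩
  · refine ⟨_, rfl, ?_⟩
    simp only [Holds, run_zero, cell_init_k₀, hu, Option.map_some]
  · refine ⟨_, rfl, ?_⟩
    simp only [Holds, run_zero, cell_init_k₀]
    rcases h' : u[tval pv]? with _ | b
    · exact absurd h' (by rw [List.getElem?_eq_getElem hlt]; simp)
    · cases b
      · rfl
      · exact absurd h' hu
  · refine ⟨_, rfl, ?_⟩
    simp only [Holds, run_zero, cell_init_k₀, List.getElem?_eq_none (not_lt.mp hge), Option.map_none]
  · exact ⟨_, rfl, by simp only [Holds, run_zero, cell_initList_ne tm _ hk]⟩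

/-- Completeness of the initial clause: it produces every true fact about time `0`. [folklore] -/
theorem initSem_complete {u : List Bool} {sy : Bool → tm.Γ tm.k₀} {a : Fin (A tm d) → Fin N}
    (ha : a ∈ Conf hN (initList tm (u.map sy))) (ht : tval (timeOf a) = 0) :
    InitSem hN u sy (timeOf a) (posOf a) (contOf a) := by
  refine ⟨ht, ?_⟩
  obtain ⟨x, hx, hh⟩ := ha
  rw [ht] at hh
  rcases x with ⟨l, v⟩ | ⟨k, γ⟩
  · simp only [Holds, run_zero] at hh
    obtain ⟨hp, hl, hv⟩ := hh
    left
    refine ⟨hp, ?_⟩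
    rw [hx, ← hl, ← hv]; rfl
  · simp only [Holds, run_zero] at hh
    right
    by_cases hk : k = tm.k₀
    · subst hk
      left
      rw [cell_init_k₀] at hh
      rcases h' : u[tval (posOf a)]? with _ | b
      · rw [h', Option.map_none] at hh
        subst hh
        right; right
        exact ⟨fun hlt => by rw [List.getElem?_eq_getElem hlt] at h'; simp at h', hx⟩
      · rw [h', Option.map_some] at hh
        subst hh
        have hlt : tval (posOf a) < u.length := by
          by_contra hge
          rw [List.getElem?_eq_none (not_lt.mp hge)] at h'; simp at h'
        cases b
        · right; left; exact ⟨hlt, by simp, hx⟩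
        · left; exact ⟨rfl, hx⟩
    · right
      rw [cell_initList_ne tm _ hk] at hh
      subst hh
      exact ⟨k, hk, hx⟩

/-! #### Step facts -/

/-- Soundness of the step clause (window lemma `TM2Sim.getElem?_stepTotal_stk`): from the true local data at time `t`, it only produces true facts about time `t + 1`. [folklore] -/
theorem conclSem_sound (hN2 : 2 ≤ N) {u : List Bool} {sy : Bool → tm.Γ tm.k₀}
    (hH : ∀ t < N ^ d, ∀ k, ((run tm (initList tm (u.map sy)) t).stk k).length ≤ N ^ d)
    {S : Set (Fin (A tm d) → Fin N)} (hS : S ⊆ Conf hN (initList tm (u.map sy)))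
    {t₀ tv pv : Fin d → Fin N} {ev : Fin (cM tm) → Fin N} (ht : tval tv = tval t₀ + 1)
    (h : ConclSem hN S (ld tm (run tm (initList tm (u.map sy)) (tval t₀))) t₀ pv ev) :
    mkFact tv pv ev ∈ Conf hN (initList tm (u.map sy)) := by
  set c₀ := initList tm (u.map sy) with hc₀
  have hgood : TM2Sim.Good tm (run tm c₀ (tval t₀)) := good_run (TM2Sim.good_initList tm _) _
  simp only [mem_conf_iff, contOf_mkFact, timeOf_mkFact, posOf_mkFact, ht]
  rcases h with ⟨hp, rfl⟩ | ⟨k, hk⟩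
  · refine ⟨_, rfl, ?_⟩
    simp only [Holds, run_succ, hp, true_and]
    exact ctrl_stepTotal tm hgood
  · rcases hk with ⟨j, hj, rfl⟩ | ⟨hnot, hrest⟩
    · refine ⟨_, rfl, ?_⟩
      simp only [Holds, run_succ, cell_stepTotal tm hgood, hj, j.2, if_true]
    · have hL : ((next tm (ld tm (run tm c₀ (tval t₀)))).stk k).length ≤ tval pv := by
        by_contra hlt
        exact hnot ⟨⟨tval pv, not_le.mp hlt⟩, rfl⟩
      rcases hrest with ⟨p₂, hp₂, γ, rfl, hfact⟩ | ⟨hno, rfl⟩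
      · refine ⟨_, rfl, ?_⟩
        have h2 := (mkFact_mem_conf_iff hN2 c₀ t₀ p₂ _).mp (hS hfact)
        simp only [Holds] at h2 ⊢
        rw [run_succ, cell_stepTotal tm hgood, if_neg (not_lt.mpr hL), ← h2]
        congr 1; omega
      · refine ⟨_, rfl, ?_⟩
        simp only [Holds]
        rw [run_succ, cell_stepTotal tm hgood, if_neg (not_lt.mpr hL)]
        apply cell_eq_none_of_le
        have := hH (tval t₀) (tval_lt _) k
        by_contra hlt
        push Not at hlt
        obtain ⟨p₂, hp₂⟩ := exists_tval_eq (N := N) (d := d)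
          (m := tval pv - ((next tm (ld tm (run tm c₀ (tval t₀)))).stk k).length + D tm) (by omega)
        exact hno ⟨p₂, by omega⟩

/-- Completeness of the step clause: given all true facts of time `t`, it produces every true fact about time `t + 1` (the height bound keeps every cell addressable). [folklore] -/
theorem conclSem_complete {u : List Bool} {sy : Bool → tm.Γ tm.k₀}
    (hH : ∀ t < N ^ d, ∀ k, ((run tm (initList tm (u.map sy)) t).stk k).length ≤ N ^ d)
    {S : Set (Fin (A tm d) → Fin N)} {t₀ : Fin d → Fin N}
    (hS : ∀ (pv : Fin d → Fin N) (x : Content tm), Holds (initList tm (u.map sy)) x (tval t₀) (tval pv) →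
      mkFact t₀ pv (codeVal N hN (ccode tm x)) ∈ S)
    {a : Fin (A tm d) → Fin N} (ha : a ∈ Conf hN (initList tm (u.map sy)))
    (ht : tval (timeOf a) = tval t₀ + 1) :
    ConclSem hN S (ld tm (run tm (initList tm (u.map sy)) (tval t₀))) t₀ (posOf a) (contOf a) := by
  set c₀ := initList tm (u.map sy) with hc₀
  have hgood : TM2Sim.Good tm (run tm c₀ (tval t₀)) := good_run (TM2Sim.good_initList tm _) _
  obtain ⟨x, hx, hh⟩ := ha
  rw [ht] at hh
  rcases x with ⟨l, v⟩ | ⟨k, γ⟩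
  · simp only [Holds, run_succ] at hh
    obtain ⟨hp, hl, hv⟩ := hh
    left
    refine ⟨hp, ?_⟩
    rw [hx, ← hl, ← hv, (ctrl_stepTotal tm hgood).1, (ctrl_stepTotal tm hgood).2]
  · simp only [Holds] at hh
    rw [run_succ, cell_stepTotal tm hgood] at hh
    right
    refine ⟨k, ?_⟩
    set W := (next tm (ld tm (run tm c₀ (tval t₀)))).stk k with hW
    have hWl : W.length = ((next tm (ld tm (run tm c₀ (tval t₀)))).stk k).length := by rw [hW]
    by_cases hlt : tval (posOf a) < W.length
    · rw [if_pos hlt] at hh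
      left
      exact ⟨⟨_, hlt⟩, rfl, by rw [hx, ← hh]⟩
    · rw [if_neg hlt] at hh
      right
      refine ⟨fun ⟨j, hj⟩ => hlt (hj ▸ j.2), ?_⟩
      by_cases hrange : tval (posOf a) - W.length + D tm < N ^ d
      · left
        obtain ⟨p₂, hp₂⟩ := exists_tval_eq (N := N) (d := d) hrange
        refine ⟨p₂, by omega, γ, hx, hS p₂ _ ?_⟩
        simp only [Holds]
        rw [hp₂, hh]
      · right
        refine ⟨fun ⟨p₂, hp₂⟩ => hrange ?_, ?_⟩
        · have := tval_lt p₂; omega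
        · rw [hx, ← hh, cell_eq_none_of_le]
          have := hH (tval t₀) (tval_lt _) k
          omega

/-- **Correctness of the simulation induction**: its inflationary fixed point is exactly the set
of (codes of) true facts about the run. [cite: Gurevich1984, §4 Theorems 2–3 ((1)→(3))] -/
theorem ifp_FSem_eq_conf (hN2 : 2 ≤ N) (hDd : D tm < N ^ d) (u : List Bool) (sy : Bool → tm.Γ tm.k₀)
    (hH : ∀ t < N ^ d, ∀ k, ((run tm (initList tm (u.map sy)) t).stk k).length ≤ N ^ d) :
    ifp (fun S : Set (Fin (A tm d) → Fin N) => {a | FSem hN S u sy a}) = Conf hN (initList tm (u.map sy)) := by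
  apply ifp_eq_of_rank (fun a => tval (timeOf a))
  · intro i hi a ha
    rw [← mkFact_eta a]
    rcases ha with hinit | ⟨t₀, ht, w, hmatch, hconcl⟩
    · exact initSem_sound hinit
    · have hw := eq_ld_of_matchSem hN2 hi hmatch
      subst hw
      exact conclSem_sound hN2 hH hi ht hconcl
  · intro a ha S hlow hS
    show FSem hN S u sy a
    rcases h : tval (timeOf a) with _ | t
    · exact Or.inl (initSem_complete ha h)
    · right
      obtain ⟨t₀, ht₀⟩ := exists_tval_eq (N := N) (d := d) (m := t) (by have := tval_lt (timeOf a); omega)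
      have hfacts : ∀ (pv : Fin d → Fin N) (x : Content tm),
          Holds (initList tm (u.map sy)) x (tval t₀) (tval pv) → mkFact t₀ pv (codeVal N hN (ccode tm x)) ∈ S := by
        intro pv x hx
        apply hlow
        refine ⟨(mkFact_mem_conf_iff hN2 _ t₀ pv x).mpr hx, ?_⟩
        show tval (timeOf (mkFact t₀ pv _)) < tval (timeOf a)
        rw [timeOf_mkFact]; omega
      refine ⟨t₀, by omega, ld tm (run tm (initList tm (u.map sy)) (tval t₀)),
        matchSem_ld hDd hfacts, ?_⟩
      exact conclSem_complete hH hfacts ha (by omega)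


/-! #### The fact relation and acceptance, evaluated -/

variable {ar : List ℕ} (R : RelTables ar N) {rv' : List ℕ} {m : ℕ} (V' : RVAssign rv' N) (τ : Fin m → Fin N)

/-- **Semantics of the fact relation**: `Conf(t̄, p̄, ē)` holds iff `ē` codes a true fact about
the run at time `t̄`, position `p̄`. [cite: Gurevich1984, §4 Theorems 2–3 ((1)→(3))] -/
theorem eval_confRel (hN2 : 2 ≤ N) (hDd : D tm < N ^ d) {inLen inTrue : TBuilder ar 0 d}
    {u : List Bool} (sy : Bool → tm.Γ tm.k₀)
    (hLen : TBuilder.Realizes R inLen fun _ pv => tval pv < u.length)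
    (hTrue : TBuilder.Realizes R inTrue fun _ pv => u[tval pv]? = some true)
    (hH : ∀ t < N ^ d, ∀ k, ((run tm (initList tm (u.map sy)) t).stk k).length ≤ N ^ d)
    (t p : Fin d → Fin m) (e : Fin (cM tm) → Fin m) :
    (confRel inLen inTrue sy t p e : Formula (2 :: ar) rv' m).eval (withNatOrder R) V' τ ↔
      mkFact (τ ∘ t) (τ ∘ p) (τ ∘ e) ∈ Conf hN (initList tm (u.map sy)) := by
  rw [confRel, Formula.eval_fp']
  simp only [eval_simBody hN _ R V' hLen hTrue]
  rw [ifp_FSem_eq_conf hN2 hDd u sy hH]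
  have : τ ∘ Fin.append (Fin.append t p) e = mkFact (τ ∘ t) (τ ∘ p) (τ ∘ e) := by
    funext i
    refine Fin.addCases (fun i => ?_) (fun i => ?_) i
    · refine Fin.addCases (fun i => ?_) (fun i => ?_) i <;>
        simp only [mkFact, Fin.append_left, Fin.append_right, Function.comp_apply]
    · simp only [mkFact, Fin.append_right, Function.comp_apply]
  rw [this]

/-- `Conf(t̄, j₀, code x)` for a numeral position. [folklore] -/
def confC (inLen inTrue : TBuilder ar 0 d) (sy : Bool → tm.Γ tm.k₀) (t : Fin d → Fin m) (j₀ : ℕ)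
    (x : Content tm) : Formula (2 :: ar) rv' m :=
  Formula.exs (d + cM tm)
    (.and (Formula.isConstT j₀ (Fin.natAdd m ∘ Fin.castAdd (cM tm)))
      (.and (Formula.isCode (ccode tm x) (Fin.natAdd m ∘ Fin.natAdd d))
        (confRel inLen inTrue sy (Fin.castAdd (d + cM tm) ∘ t) (Fin.natAdd m ∘ Fin.castAdd (cM tm))
          (Fin.natAdd m ∘ Fin.natAdd d))))

/-- Semantics of `confC`: the content `x` holds at time `t̄`, position `j₀`. [folklore] -/
theorem eval_confC (hN : 1 ≤ N) (hN2 : 2 ≤ N) (hDd : D tm < N ^ d) {inLen inTrue : TBuilder ar 0 d}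
    {u : List Bool} (sy : Bool → tm.Γ tm.k₀)
    (hLen : TBuilder.Realizes R inLen fun _ pv => tval pv < u.length)
    (hTrue : TBuilder.Realizes R inTrue fun _ pv => u[tval pv]? = some true)
    (hH : ∀ t < N ^ d, ∀ k, ((run tm (initList tm (u.map sy)) t).stk k).length ≤ N ^ d)
    (t : Fin d → Fin m) (j₀ : ℕ) (hj₀ : j₀ < N ^ d) (x : Content tm) :
    (confC inLen inTrue sy t j₀ x : Formula (2 :: ar) rv' m).eval (withNatOrder R) V' τ ↔
      Holds (initList tm (u.map sy)) x (tval (τ ∘ t)) j₀ := by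
  simp only [confC, Formula.eval_exs, Formula.eval_and', Formula.eval_isConstT, Formula.eval_isCode R _ _ hN,
    eval_confRel (hN := hN) R _ _ hN2 hDd sy hLen hTrue hH]
  have e1 : ∀ b : Fin (d + cM tm) → Fin N, Fin.append τ b ∘ (Fin.natAdd m ∘ Fin.castAdd (cM tm)) =
      b ∘ Fin.castAdd (cM tm) := by intro b; funext i; simp
  have e2 : ∀ b : Fin (d + cM tm) → Fin N, Fin.append τ b ∘ (Fin.natAdd m ∘ Fin.natAdd d) =
      b ∘ Fin.natAdd d := by intro b; funext i; simp
  have e3 : ∀ b : Fin (d + cM tm) → Fin N, Fin.append τ b ∘ (Fin.castAdd (d + cM tm) ∘ t) = τ ∘ t := by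
    intro b; funext i; simp
  simp only [e1, e2, e3]
  constructor
  · rintro ⟨b, hb1, hb2, hb3⟩
    rw [hb2, mkFact_mem_conf_iff hN2, hb1] at hb3
    exact hb3
  · intro h
    obtain ⟨pv, hpv⟩ := exists_tval_eq (N := N) (d := d) hj₀
    refine ⟨Fin.append pv (codeVal N hN (ccode tm x)), ?_, ?_, ?_⟩
    · rw [append_comp_castAdd']; exact hpv
    · rw [append_comp_natAdd]
    · rw [append_comp_castAdd', append_comp_natAdd, mkFact_mem_conf_iff hN2, hpv]; exact h

/-- **Acceptance**: at some time the machine has halted with the designated symbol on top of the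
output stack. [cite: Gurevich1984, §4 Theorems 2–3 ((1)→(3))] -/
def accF (inLen inTrue : TBuilder ar 0 d) (sy : Bool → tm.Γ tm.k₀) (γ₁ : Sym tm tm.k₁) :
    Formula (2 :: ar) rv' m :=
  Formula.exs d (.and
    (Formula.fOr fun v : tm.σ => confC inLen inTrue sy (Fin.natAdd m) 0 (Sum.inl (none, v)))
    (confC inLen inTrue sy (Fin.natAdd m) 0 (Sum.inr ⟨tm.k₁, some γ₁⟩)))

/-- **Semantics of acceptance**: at some time `t < N ^ d` the run has halted with the designated symbol on top of the output stack. [cite: Gurevich1984, §4 Theorems 2–3 ((1)→(3))] -/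
theorem eval_accF (hN : 1 ≤ N) (hN2 : 2 ≤ N) (hDd : D tm < N ^ d) {inLen inTrue : TBuilder ar 0 d}
    {u : List Bool} (sy : Bool → tm.Γ tm.k₀) (γ₁ : Sym tm tm.k₁)
    (hLen : TBuilder.Realizes R inLen fun _ pv => tval pv < u.length)
    (hTrue : TBuilder.Realizes R inTrue fun _ pv => u[tval pv]? = some true)
    (hH : ∀ t < N ^ d, ∀ k, ((run tm (initList tm (u.map sy)) t).stk k).length ≤ N ^ d) :
    (accF inLen inTrue sy γ₁ : Formula (2 :: ar) rv' m).eval (withNatOrder R) V' τ ↔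
      ∃ t < N ^ d, (run tm (initList tm (u.map sy)) t).l = none ∧
        cell tm (run tm (initList tm (u.map sy)) t) tm.k₁ 0 = some γ₁ := by
  have h0 : 0 < N ^ d := by omega
  simp only [accF, Formula.eval_exs, Formula.eval_and', Formula.eval_fOr,
    eval_confC R _ _ hN hN2 hDd sy hLen hTrue hH _ 0 h0, append_comp_natAdd, Holds, true_and]
  constructor
  · rintro ⟨tv, ⟨v, hl, -⟩, hc⟩
    exact ⟨tval tv, tval_lt tv, hl, hc⟩
  · rintro ⟨t, ht, hl, hc⟩
    obtain ⟨tv, htv⟩ := exists_tval_eq (N := N) (d := d) ht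
    refine ⟨tv, ⟨(run tm (initList tm (u.map sy)) t).var, ?_, ?_⟩, ?_⟩
    · rw [htv]; exact hl
    · rw [htv]
    · rw [htv]; exact hc

end Correctness

end LFPSim

end

end Literature.ModelTheory.FiniteModelTheory
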